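import Literature.Probability.Percolation.ArmSeparationIntSurgeryFour
import Literature.Probability.Percolation.ArmSeparationExtArm
import Literature.Probability.Percolation.ArmSeparationRotate
import Literature.Probability.Percolation.TriBallDisc
import Literature.Combinatorics.SimpleGraph.MengerTwo
import HarnessLib

/-!
# Clean inner arms from outer-landed arms (the input of the inner surgery, pattern `R`)

Topic `Literature/Probability/Percolation`; family `crit-perc` / near-critical percolation on `𝕋`.
A brick of the INNER half of the near-critical arm-separation theorem for four arms in the ADJACENT
colour arrangement (P. Nolin, EJP 13 (2008), Thm. 11, `j = 4`, `σ = BBWW` [arXiv 0711.4948: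
Thm. 10], §4.4, internal extremities). From an outer-landed arm `χ ∩ X ∈ extOpenArm m N` (landing
site `zo`, outer free-space crossing through `uo`, open path of the arm region from `∂Λ_m` to `uo`):
the CLEAN inner arm — the self-avoiding walk from the far end `uo` (`|uo| ≥ N + 1 > 2m`) to its first
site `y = ρ^i (m, t)` of `∂Λ_m` — together with the certificate piece: the sub-walk from `y` to
its first site `w` of `∂Λ_{N+1}`, which lies in the landing ball, so that `hexPos (N+1) (ρ^s w)`
lies in the block of the side `s` (`exists_clean_int_arm`, `hexPos_rot_block_of_mem_ball`).

Everything here is proved; no named facts are introduced.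

## References

* P. Nolin, Near-critical percolation in two dimensions, *Electron. J. Probab.* 13 (2008), §4.2
  Def. 6–8 and §4.4, internal extremities (arXiv 0711.4948: Def. 6–8; proof of Thm. 10, p. 13)
  [Nolin2008].
-/

noncomputable section

open Set

namespace Literature.Probability.Percolation

open LatticeModels SimpleGraph
open Literature.Combinatorics.SimpleGraph

/-- **The perimeter block of a rotated landing ball**: a site `w` of norm `N + 1` of the landing
ball of `zo ∈ sepLanding N` satisfies `s (N+1) ≤ hexPos (N+1) (ρ^s w) < (s+1) (N+1)`. [folklore] -/
theorem hexPos_rot_block_of_mem_ball {N s : ℕ} (hs : s < 6) {zo w : Site 2} (hzo : zo ∈ sepLanding N) (hw : w ∈ triOpenBall zo (N / 8))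
    (hwn : triNorm w = (N + 1 : ℕ)) :
    (s : ℤ) * (N + 1 : ℕ) ≤ hexPos (N + 1) (triRotIsoPow s w) ∧ hexPos (N + 1) (triRotIsoPow s w) < (s + 1) * (N + 1 : ℕ) := by
  obtain ⟨hwe, hy, hy0⟩ := eq_side0_of_mem_landing_ball hzo hw hwn
  rw [hwe, hexPos_rot_side0 hs hy.le hy0]
  push_cast at hy hy0 ⊢
  have e : ((s : ℤ) + 1) * ((N : ℤ) + 1) = (s : ℤ) * ((N : ℤ) + 1) + ((N : ℤ) + 1) := by ring
  constructor <;> nlinarith [hy, hy0, e]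

/-- **Discrete intermediate values of the norm along a walk**: from a site of norm `≤ L` to a
site of norm `≥ L` a walk visits a site of norm exactly `L` (norms change by at most one along an
edge). [folklore] -/
theorem Walk.exists_mem_support_triNorm_eq {L : ℤ} : ∀ {u v : Site 2} (W : triGraph.Walk u v), triNorm u ≤ L → L ≤ triNorm v →
    ∃ x ∈ W.support, triNorm x = L
  | u, _, Walk.nil, hu, hv => ⟨u, by simp, le_antisymm hu hv⟩
  | u, v, Walk.cons (v := u') hadj W', hu, hv => by
    by_cases h : triNorm u = L
    · exact ⟨u, by simp, h⟩
    · have hu' : triNorm u' ≤ L := by have := triNorm_le_triNorm_add_one_of_adj hadj; omega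
      obtain ⟨x, hx, hxL⟩ := Walk.exists_mem_support_triNorm_eq W' hu' hv
      exact ⟨x, by rw [Walk.support_cons]; exact List.mem_cons_of_mem _ hx, hxL⟩

/-- **The clean inner arm of an outer-landed arm, with its certificate piece.** [cite: Nolin2008, §4.2 Def. 6–8 and §4.4, internal extremities (arXiv 0711.4948: proof of Thm. 10, p. 13)] -/
theorem exists_clean_int_arm {m N : ℕ} (hm : 1 ≤ m) (hmN : 2 * m < N) {χ : SiteConfig (Site 2)} {X : Set (Site 2)}
    (h : (χ ∩ X : Set (Site 2)) ∈ extOpenArm m N) :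
    ∃ (zo uo y w : Site 2) (W : triGraph.Walk uo y) (i : ℕ) (t : ℤ),
      zo ∈ sepLanding N ∧
      OpenVCrossThrough (sepOuterFence N zo) (zo 1 - (N / 64 : ℕ)) (zo 1 + (N / 64 : ℕ)) (χ ∩ X) uo ∧
      W.IsPath ∧ (∀ v ∈ W.support, (m : ℤ) ≤ triNorm v ∧ triNorm v ≤ (N + N / 8 : ℕ)) ∧
      (∀ v ∈ W.support, v ∈ χ ∧ v ∈ X) ∧ (∀ v ∈ W.support, v ∈ triAnnulusSet m N ∪ triOpenBall zo (N / 8)) ∧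
      (∀ v ∈ W.support, triNorm v = m → v = y) ∧ 2 * (m : ℤ) < triNorm uo ∧
      i < 6 ∧ y = triRotIsoPow i ![(m : ℤ), t] ∧ (-(m : ℤ) ≤ t ∧ t ≤ 0) ∧
      triNorm w = (N + 1 : ℕ) ∧ w ∈ triOpenBall zo (N / 8) ∧
      ∃ C : Set (Site 2), C ⊆ {v | v ∈ W.support} ∧ PathIn triGraph C y w ∧
        (∀ v ∈ C, triNorm v = (N + 1 : ℕ) → v = w) ∧ (∀ v ∈ C, triNorm v = m → v = y) := by
  classical
  obtain ⟨zo, uo, a, hzo, ha, hOut, P⟩ := h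
  -- the far end lies on the outer fence
  have huo : (N : ℤ) + 1 ≤ uo 0 := by
    obtain ⟨b, t, -, -, P1, -⟩ := hOut
    exact (mem_sepOuterFence.1 P1.right_mem.1).1
  have huoN : (N : ℤ) + 1 ≤ triNorm uo := le_trans huo (le_triNorm_iff_lin.2 (Or.inl le_rfl))
  have huo2 : 2 * (m : ℤ) < triNorm uo := by omega
  -- a self-avoiding walk from the far end to `a` inside the arm region and `χ ∩ X`
  obtain ⟨W₀, hW₀⟩ := P.symm.exists_walk
  set W₁ : triGraph.Walk uo a := (W₀.toPath : triGraph.Walk uo a) with hW₁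
  have hW₁s : ∀ v ∈ W₁.support, v ∈ (triAnnulusSet m N ∪ triOpenBall zo (N / 8)) ∩ (χ ∩ X : Set (Site 2)) :=
    fun v hv => hW₀ v (Walk.support_toPath_subset_support W₀ hv)
  have hW₁p : W₁.IsPath := W₀.toPath.2
  -- norms along the walk
  have hball : ∀ v ∈ triOpenBall zo (N / 8), (N : ℤ) - (N / 8 : ℕ) < triNorm v ∧ triNorm v ≤ (N + N / 8 : ℕ) := by
    intro v hv
    rw [mem_sepLanding] at hzo
    rw [mem_triOpenBall, triNorm_lt_iff_lin] at hv
    simp only [Pi.sub_apply] at hv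
    have hz4 : 4 * (N / 4) ≤ N := Nat.mul_div_le N 4
    have hz64 : 64 * (N / 64) ≤ N := Nat.mul_div_le N 64
    constructor
    · have := (le_triNorm_iff_lin (x := v) (ρ := (N : ℤ) - (N / 8 : ℕ) + 1)).2 (Or.inl (by omega)); omega
    · refine (triNorm_le_iff_lin (x := v)).2 ⟨?_, ?_, ?_, ?_, ?_, ?_⟩ <;> push_cast <;> omega
  have hnorm : ∀ v ∈ W₁.support, (m : ℤ) ≤ triNorm v ∧ triNorm v ≤ (N + N / 8 : ℕ) := by
    intro v hv
    rcases (hW₁s v hv).1 with hv' | hv'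
    · have := mem_triAnnulusSet.1 hv'; push_cast; omega
    · have := hball v hv'; have h8 : 8 * (N / 8) ≤ N := Nat.mul_div_le N 8; push_cast at this ⊢; omega
  -- the first site of norm `m`
  obtain ⟨y, p₁, p₂, hW, hyL, hfirst⟩ := exists_append_first_mem {v : Site 2 | triNorm v = m} W₁ ⟨a, W₁.end_mem_support, ha⟩
  have hp₁s : ∀ v ∈ p₁.support, v ∈ W₁.support := fun v hv => by rw [hW, Walk.mem_support_append_iff]; exact Or.inl hv
  have hp₁p : p₁.IsPath := by
    have := hW₁p; rw [hW] at this; exact this.of_append_left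
  -- the side of `y`
  obtain ⟨i, hi, hi0⟩ := exists_rot_symm_apply_zero_eq y
  have hyn : triNorm y = m := hyL
  set t : ℤ := ((triRotIsoPow i).symm y) 1 with ht
  have hyeq : y = triRotIsoPow i ![(m : ℤ), t] := by
    have e : (triRotIsoPow i).symm y = ![(m : ℤ), t] := by
      refine Site.eq_iff_two.2 ⟨?_, rfl⟩
      rw [hi0, hyn]; rfl
    rw [← e, RelIso.apply_symm_apply]
  have htb : -(m : ℤ) ≤ t ∧ t ≤ 0 := by
    have hn' : triNorm ((triRotIsoPow i).symm y) = m := by rw [triNorm_rot_symm]; exact hyn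
    have h0 : ((triRotIsoPow i).symm y) 0 = m := by rw [hi0, hyn]
    have hlin := (triNorm_le_iff_lin (x := (triRotIsoPow i).symm y) (ρ := (m : ℤ))).1 hn'.le
    rw [h0] at hlin
    change -(m : ℤ) ≤ ((triRotIsoPow i).symm y) 1 ∧ ((triRotIsoPow i).symm y) 1 ≤ 0
    omega
  -- the certificate piece: from `y`, the first site of norm `N + 1` along the reversed `p₁`
  have hex : ∃ x ∈ p₁.reverse.support, x ∈ {v : Site 2 | triNorm v = (N + 1 : ℕ)} :=
    Walk.exists_mem_support_triNorm_eq p₁.reverse (by rw [hyn]; push_cast; omega) (by push_cast; exact huoN)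
  obtain ⟨w, q₁, q₂, hq, hwL, hwfirst⟩ := exists_append_first_mem {v : Site 2 | triNorm v = (N + 1 : ℕ)} p₁.reverse hex
  have hq₁s : ∀ v ∈ q₁.support, v ∈ p₁.support := fun v hv => by
    have : v ∈ p₁.reverse.support := by rw [hq, Walk.mem_support_append_iff]; exact Or.inl hv
    rwa [Walk.support_reverse, List.mem_reverse] at this
  have hwn : triNorm w = (N + 1 : ℕ) := hwL
  have hwball : w ∈ triOpenBall zo (N / 8) := by
    rcases (hW₁s w (hp₁s w (hq₁s w q₁.end_mem_support))).1 with hw' | hw'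
    · exfalso; have := (mem_triAnnulusSet.1 hw').2; push_cast at hwn; omega
    · exact hw'
  refine ⟨zo, uo, y, w, p₁, i, t, hzo, hOut, hp₁p, fun v hv => hnorm v (hp₁s v hv), fun v hv => (hW₁s v (hp₁s v hv)).2,
    fun v hv => (hW₁s v (hp₁s v hv)).1, fun v hv hvn => hfirst v hv hvn, huo2, hi, hyeq, htb, hwn, hwball,
    {v | v ∈ q₁.support}, fun v hv => hq₁s v hv, (PathIn.of_walk_mem_support q₁ (A := {v | v ∈ q₁.support}) (fun v hv => hv) q₁.end_mem_support).1,
    fun v hv hvn => hwfirst v hv hvn, fun v hv hvn => hfirst v (hq₁s v hv) hvn⟩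

end Literature.Probability.Percolation
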